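import Summits.ABC.IUTFork.Repair.RHInnerConductorTieGenuine
import HarnessLib

/-!
# D-0079 RESCUE sub-cell R-H (row 15, register «15R» at the DEEP wild ties): the KERNEL DOOR for the deep-tie certificate —
# insolubility of `‖u^p − ζ_p‖ ≤ ‖p‖·‖ϖ‖^A` for a primitive `p`-TH root `ζ_p` ⟺ `m_w = 1 ∧ c_w = A + 1` (15R LICENSED)

PROOF-ONLY wiring file (0 definitions, 0 `Prop` facts; seat abc-iut-rh-typ-12 gen 7, row-15 register lineage p480437
`Repair.RHInnerConductorTie` / p481931 `Repair.RHInnerConductorTieGenuine`; rung LADDER-ABC:A2.RESCUE.H).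

WHY. At a tie `e_w = A·(p−1)` (`p` odd) with `ζ_p ∈ K_w` and `p^{m_w} ∣ A` (a DEEP tie; `m_w = torsionPExp p K_w`), the register
15R (`n₀ = ⌊e_w/(p−1)⌋ + 1`) is licensed iff the inner conductor is `c_w = A + 1`, and p480437's `isInnerConductor_tie_succ_iff_generator`
decides that by ONE congruence — but on a primitive `p^{m_w}`-TH root of unity `ξ`, where the exponent `m_w` is itself unknown a priori at
the 32 deep genuine rows (`(p, e_v) ∈ {(3,30), (5,20), (5,60)}`). The numerics seat's TWO-ENGINE CERTIFICATE (abc-iut-rh-kit-1 g4 PASS 14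
«TIES-86», kit j265311 / j265986; DEEP-TIE-LEMMA.md 53ff5c7945755956, booking B53 of abc-iut-rh-lead g3) asserts, per deep row of Kummer
class W1/W2, that `K_w(ζ_{p²})/K_w` is totally ramified, i.e. classically that **the congruence for `ζ_p` ITSELF is insoluble**:
`∀ u ∈ K_w, ‖p‖·‖ϖ‖^A < ‖u^p − ζ_p‖` (and hence `m_w = 1`). THIS FILE is the kernel door for exactly that hypothesis shape, so the
certificate's per-row claim is ONE inequality over the tree's objects and everything tabulated follows BY NAME:

* §1 (one local field `K`, `p` odd, `e = A·(p−1)`, `ζ^p = 1`, `ζ ≠ 1`; hypothesis `hW : ∀ u, ‖p‖·‖ϖ‖^A < ‖u^p − ζ‖`):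
  `not_pow_prime_eq_of_forall_lt` (`ζ` is not a `p`-th power) · **`torsionPExp_eq_one_of_forall_lt`** (`m = 1`, i.e. `ζ_{p²} ∉ K` — the
  W-num-3 MODEL-AUDIT §v3.6 column «`m_w = 1`» in kernel form) · **`isInnerConductor_tie_succ_of_forall_lt`** (`c = A + 1`) ·
  **`exists_inner_certificate_rInUb_of_forall_lt`** (15R LICENSED: `∃ u ∉ log_p(𝒪_K^×), ‖u‖ ≤ ‖ϖ‖^{⌊e/(p−1)⌋}`) · the converse packaging
  **`forall_lt_iff_torsionPExp_eq_one_and_isInnerConductor_succ`**: `hW ⟺ (m = 1 ∧ c = A + 1)` — so the certificate's claim is EQUIVALENT to the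
  tabulated pair (`m_w = 1`, 15R licensed), and (`forall_lt_of_forall_lt`) independent of WHICH primitive `p`-th root is tested; at `m = 1`
  the two outcomes of the congruence are the two conductors (`isInnerConductor_tie_succ_iff_forall_lt_of_torsionPExp_eq_one`,
  `isInnerConductor_tie_iff_exists_le_of_torsionPExp_eq_one`, `not_exists_inner_certificate_rInUb_of_exists_le`: a SOLUBLE congruence at
  `m = 1` makes 15R a PHANTOM and forces `p ∣ A`).
* §2 (bed `K_x = kOf X p x` of a pilot datum `X : PilotData L`, `Cor312Prov.pilotDataOfK` included): **`torsionPExp_eq_one_and_isInnerConductor_kOf_rInUb_of_forall_lt`**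
  and **`exists_inner_certificate_rInUb_kOf_of_forall_lt`** — at a place `x ∣ p` where the congruence is insoluble for some primitive `p`-th root
  of unity of `K_x`: `(p−1) ∣ e_x`, `m_x = 1`, `c_x = e_x/(p−1) + 1 = r_in_ub(x)`, 15R certified.
* §3 (genuine Θ-volume datum `T`, `p ∈ {3, 5}`, where `ζ_p ∈ K` is structural, p481931): **`ThetaVolumeDatumAt.isInnerConductor_kOf_rInUb_of_forall_lt_of_dvd_thirty`**
  — the generator-free form: if `‖p‖·‖ϖ‖^{e_x/(p−1)} < ‖u^p − ζ'‖` for every `ζ' ≠ 1` with `ζ'^p = 1` and every `u` in `K_x`, then `m_x = 1`, the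
  conductor is `r_in_ub(x)` and 15R holds at `x`.

WHAT IS *NOT* HERE (honest sizing, HOME/abc-iut-rh-typ-12/HANDOFF.md gen-7 block): the DEEP-TIE LEMMA itself — «`ζ_p ∈ K`, `e = A(p−1)` with
`v_p(A) = 1`, `y^p = q ∈ ℚ_p^×` with `p ∤ v_p(q)` (class W1; W2 analogous) ⟹ `hW`» — whose printed proof (Kummer theory over `K·ℚ_p^{ur}`, or
Abhyankar over the tame layer `ℚ_p(ζ_p, q^{1/p}) ⊆ K`) needs the maximal tamely ramified subextension of the completion; it is L-sized and is
NOT claimed. Until it lands the deep rows stay «computed ≠ proved», entering through `hW`.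

HONEST FRAMING: pure local algebra about `log_p(𝒪^×)` + the tree's typed beds; every R-H candidate remains a HYPOTHESIS; nothing here
asserts abc proved or refuted; no side is taken on [IUTchIII] Cor. 3.12 or on any author; typed ≠ proved; computed ≠ proved; certified ≠ endorsed.
-/

noncomputable section

open Set Metric NumberField IsDedekindDomain

namespace Summit.ABC.IUTFork.Repair.RH.DeepTie

open Literature.IUT.LogVolume Literature.IUT.LogVolume.LogEnvelope Literature.NumberTheory.GaloisRepresentations.Ultrametric
  Literature.NumberTheory.NumberFields Summit.ABC.IUTFork.Repair.RH.LinearReachLaw Summit.ABC.IUTFork.Repair.RH.InnerConductorTie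
  Summit.ABC.IUTFork.Thm311 Summit.ABC.IUTFork.Thm311.Real Summit.ABC.IUTFork.Cor312 Summit.ABC.IUTFork.Cor312Prov

/-! ## §1. One local field: the certificate's hypothesis shape `hW` and everything it decides -/

section Field

variable (p : ℕ) [hp : Fact p.Prime]
variable {K : Type*} [NontriviallyNormedField K] [instK : NormedAlgebra ℚ_[p] K] [IsUltrametricDist K] [ProperSpace K]

omit hp instK [IsUltrametricDist K] [ProperSpace K] in
/-- **An insoluble congruence leaves no exact root**: if `‖p‖·‖ϖ‖^A < ‖u^p − ζ‖` for every `u`, then `ζ` is not a `p`-th power in `K`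
(an exact `p`-th root would give norm `0`). [cite: SerreLocalFields1979, Ch. XIV §4] -/
theorem not_pow_prime_eq_of_forall_lt {ϖ : Kˣ} {A : ℕ} {ζ : K} (hW : ∀ u : K, ‖(p : K)‖ * ‖(ϖ : K)‖ ^ A < ‖u ^ p - ζ‖)
    (η : K) : η ^ p ≠ ζ := by
  intro h
  have h' := hW η
  rw [h, sub_self, norm_zero] at h'
  exact absurd h' (not_lt.2 (by positivity))

omit instK [IsUltrametricDist K] [ProperSpace K] in
/-- A `ζ ≠ 1` with `ζ^p = 1` is a primitive `p^1`-th root of unity (`p` prime). [cite: NeukirchANT1999, Ch. II (5.7)] -/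
theorem isPrimitiveRoot_pow_one_of_pow_prime_eq_one {ζ : K} (hζ : ζ ^ p = 1) (hζ1 : ζ ≠ 1) : IsPrimitiveRoot ζ (p ^ 1) := by
  rw [pow_one, ← orderOf_eq_prime hζ hζ1]
  exact IsPrimitiveRoot.orderOf ζ

/-- **`hW ⇒ m = torsionPExp p K = 1`** (`ζ_p ∈ K` gives `m ≥ 1`; if `m ≥ 2` a primitive `p^m`-th root of unity `ξ` has `ξ^{pj} = ζ` for some `j`,
an exact `p`-th root of `ζ`). This is the W-num-3 column «`m_w = 1`» (`ζ_{p²} ∉ K_w`) read off the same inequality the certificate asserts.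
[cite: NeukirchANT1999, Ch. II Prop. (5.7)] [cite: SerreLocalFields1979, Ch. XIV §4] -/
theorem torsionPExp_eq_one_of_forall_lt {ϖ : Kˣ} {A : ℕ} {ζ : K} (hζ : ζ ^ p = 1) (hζ1 : ζ ≠ 1)
    (hW : ∀ u : K, ‖(p : K)‖ * ‖(ϖ : K)‖ ^ A < ‖u ^ p - ζ‖) : torsionPExp p K = 1 := by
  have h1 : 1 ≤ torsionPExp p K := le_torsionPExp_of_isPrimitiveRoot p (isPrimitiveRoot_pow_one_of_pow_prime_eq_one p hζ hζ1)
  by_contra hne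
  have h2 : 2 ≤ torsionPExp p K := by omega
  obtain ⟨ξ, hξ⟩ := exists_isPrimitiveRoot_pow_torsionPExp p K
  haveI : NeZero (p ^ torsionPExp p K) := ⟨(pow_pos hp.out.pos _).ne'⟩
  have hζm : ζ ^ p ^ torsionPExp p K = 1 := by
    obtain ⟨m', hm'⟩ := Nat.exists_eq_add_one_of_ne_zero (by omega : torsionPExp p K ≠ 0)
    rw [hm', pow_succ', pow_mul, hζ, one_pow]
  obtain ⟨i, -, hi⟩ := hξ.eq_pow_of_pow_eq_one hζm
  have hdvd : p ^ torsionPExp p K ∣ i * p := by rw [← hξ.pow_eq_one_iff_dvd, pow_mul, hi, hζ]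
  have hpp : p * p ∣ i * p := by rw [← sq]; exact (pow_dvd_pow p h2).trans hdvd
  obtain ⟨j, rfl⟩ := Nat.dvd_of_mul_dvd_mul_right hp.out.pos hpp
  exact not_pow_prime_eq_of_forall_lt p hW (ξ ^ j) (by rw [← pow_mul, mul_comm, hi])

/-- **`hW ⇒ c = A + 1`** at a tie `e = A·(p−1)`, `p` odd: the critical ball `𝔪^A` is NOT inside `log_p(𝒪_K^×)`
(`LogEnvelope.closedBall_level_subset_logUnits_iff_generator` with the generator `ζ`, not a `p`-th power by `hW`).
[cite: SerreLocalFields1979, Ch. XIV §4] [cite: NeukirchANT1999, Ch. II Prop. (5.5)–(5.7)] -/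
theorem isInnerConductor_tie_succ_of_forall_lt {ϖ : Kˣ} (hϖ : IsUniformizer ϖ) {A : ℕ} (hA : absRamificationIdx p K = A * (p - 1))
    (hp2 : p ≠ 2) {ζ : K} (hζ : ζ ^ p = 1) (hW : ∀ u : K, ‖(p : K)‖ * ‖(ϖ : K)‖ ^ A < ‖u ^ p - ζ‖) :
    IsInnerConductor K ϖ (A + 1) := by
  rw [isInnerConductor_tie_succ_iff_not_subset p hϖ hA hp2,
    closedBall_level_subset_logUnits_iff_generator p hϖ hA hp2 (j := 1) (by rw [pow_one, hζ])
      (not_pow_prime_eq_of_forall_lt p hW)]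
  simpa only [not_exists, not_le] using hW

/-- **`hW ⇒ 15R LICENSED`**: some `u ∉ log_p(𝒪_K^×)` has `‖u‖ ≤ ‖ϖ‖^{⌊e/(p−1)⌋}` — the k2 door's `hsharp` binder at the round-1 donor
`n₀ = ⌊e/(p−1)⌋ + 1` (`Repair.RHSlotReach.SlotReachWindowK`). [cite: NeukirchANT1999, Ch. II Prop. (5.5)–(5.7)] -/
theorem exists_inner_certificate_rInUb_of_forall_lt {ϖ : Kˣ} (hϖ : IsUniformizer ϖ) {A : ℕ} (hA : absRamificationIdx p K = A * (p - 1))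
    (hp2 : p ≠ 2) {ζ : K} (hζ : ζ ^ p = 1) (hW : ∀ u : K, ‖(p : K)‖ * ‖(ϖ : K)‖ ^ A < ‖u ^ p - ζ‖) :
    ∃ u : K, ‖u‖ ≤ ‖(ϖ : K)‖ ^ (((absRamificationIdx p K / (p - 1) + 1 : ℕ) : ℤ) - 1) ∧ u ∉ logUnits K :=
  (exists_inner_certificate_rInUb_iff_isInnerConductor_succ p hϖ hA hp2).2
    (isInnerConductor_tie_succ_of_forall_lt p hϖ hA hp2 hζ hW)

/-- **THE DOOR IS TWO-WAY: `hW ⟺ (m = 1 ∧ c = A + 1)`** (`p` odd, `e = A·(p−1)`, `ζ^p = 1`, `ζ ≠ 1`). So the certificate's per-row claim is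
EQUIVALENT to the tabulated pair («`m_w = 1`», «15R licensed»), and does not depend on auxiliary choices.
[cite: SerreLocalFields1979, Ch. XIV §4] [cite: NeukirchANT1999, Ch. II Prop. (5.5)–(5.7)] -/
theorem forall_lt_iff_torsionPExp_eq_one_and_isInnerConductor_succ {ϖ : Kˣ} (hϖ : IsUniformizer ϖ) {A : ℕ}
    (hA : absRamificationIdx p K = A * (p - 1)) (hp2 : p ≠ 2) {ζ : K} (hζ : ζ ^ p = 1) (hζ1 : ζ ≠ 1) :
    (∀ u : K, ‖(p : K)‖ * ‖(ϖ : K)‖ ^ A < ‖u ^ p - ζ‖) ↔ torsionPExp p K = 1 ∧ IsInnerConductor K ϖ (A + 1) := by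
  refine ⟨fun hW => ⟨torsionPExp_eq_one_of_forall_lt p hζ hζ1 hW, isInnerConductor_tie_succ_of_forall_lt p hϖ hA hp2 hζ hW⟩, ?_⟩
  rintro ⟨hm, hc⟩
  have hprim : IsPrimitiveRoot ζ (p ^ torsionPExp p K) := by
    rw [hm]; exact isPrimitiveRoot_pow_one_of_pow_prime_eq_one p hζ hζ1
  exact (isInnerConductor_tie_succ_iff_generator p hϖ hA hp2 (by omega) hprim).1 hc

/-- **Independence of the tested root**: insolubility for ONE `ζ ≠ 1`, `ζ^p = 1` gives it for EVERY `ζ' ≠ 1`, `ζ'^p = 1`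
(both are `m = 1 ∧ c = A + 1`). [cite: SerreLocalFields1979, Ch. XIV §4] -/
theorem forall_lt_of_forall_lt {ϖ : Kˣ} (hϖ : IsUniformizer ϖ) {A : ℕ} (hA : absRamificationIdx p K = A * (p - 1)) (hp2 : p ≠ 2)
    {ζ ζ' : K} (hζ : ζ ^ p = 1) (hζ1 : ζ ≠ 1) (hζ' : ζ' ^ p = 1) (hζ'1 : ζ' ≠ 1)
    (hW : ∀ u : K, ‖(p : K)‖ * ‖(ϖ : K)‖ ^ A < ‖u ^ p - ζ‖) : ∀ u : K, ‖(p : K)‖ * ‖(ϖ : K)‖ ^ A < ‖u ^ p - ζ'‖ :=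
  (forall_lt_iff_torsionPExp_eq_one_and_isInnerConductor_succ p hϖ hA hp2 hζ' hζ'1).2
    ((forall_lt_iff_torsionPExp_eq_one_and_isInnerConductor_succ p hϖ hA hp2 hζ hζ1).1 hW)

/-- **At `m = 1` the bit for `ζ_p` IS the conductor bit**: `c = A + 1 ⟺` the congruence for `ζ` is insoluble.
[cite: SerreLocalFields1979, Ch. XIV §4] -/
theorem isInnerConductor_tie_succ_iff_forall_lt_of_torsionPExp_eq_one {ϖ : Kˣ} (hϖ : IsUniformizer ϖ) {A : ℕ}
    (hA : absRamificationIdx p K = A * (p - 1)) (hp2 : p ≠ 2) (hm : torsionPExp p K = 1) {ζ : K} (hζ : ζ ^ p = 1) (hζ1 : ζ ≠ 1) :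
    IsInnerConductor K ϖ (A + 1) ↔ ∀ u : K, ‖(p : K)‖ * ‖(ϖ : K)‖ ^ A < ‖u ^ p - ζ‖ := by
  rw [forall_lt_iff_torsionPExp_eq_one_and_isInnerConductor_succ p hϖ hA hp2 hζ hζ1]
  exact ⟨fun h => ⟨hm, h⟩, fun h => h.2⟩

/-- **… and `c = A ⟺` the congruence for `ζ` is soluble** (`m = 1`). [cite: SerreLocalFields1979, Ch. XIV §4] -/
theorem isInnerConductor_tie_iff_exists_le_of_torsionPExp_eq_one {ϖ : Kˣ} (hϖ : IsUniformizer ϖ) {A : ℕ}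
    (hA : absRamificationIdx p K = A * (p - 1)) (hp2 : p ≠ 2) (hm : torsionPExp p K = 1) {ζ : K} (hζ : ζ ^ p = 1) (hζ1 : ζ ≠ 1) :
    IsInnerConductor K ϖ A ↔ ∃ u : K, ‖u ^ p - ζ‖ ≤ ‖(p : K)‖ * ‖(ϖ : K)‖ ^ A := by
  have hprim : IsPrimitiveRoot ζ (p ^ torsionPExp p K) := by
    rw [hm]; exact isPrimitiveRoot_pow_one_of_pow_prime_eq_one p hζ hζ1
  exact isInnerConductor_tie_iff_generator p hϖ hA hp2 (by omega) hprim

/-- **A SOLUBLE congruence at `m = 1` makes 15R a PHANTOM** (no `u ∉ log_p(𝒪_K^×)` with `‖u‖ ≤ ‖ϖ‖^{⌊e/(p−1)⌋}`; the exact register is 15M)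
**and forces `p ∣ A`** (a torsion witness, `LogEnvelope.pow_torsionPExp_dvd_level_of_torsionWitness`). The certificate's «UNRAMIFIED» control
rows (`K⁺`) have this shape. [cite: SerreLocalFields1979, Ch. XIV §4] [cite: NeukirchANT1999, Ch. II Prop. (5.5)–(5.7)] -/
theorem not_exists_inner_certificate_rInUb_of_exists_le {ϖ : Kˣ} (hϖ : IsUniformizer ϖ) {A : ℕ}
    (hA : absRamificationIdx p K = A * (p - 1)) (hp2 : p ≠ 2) (hm : torsionPExp p K = 1) {ζ : K} (hζ : ζ ^ p = 1) (hζ1 : ζ ≠ 1)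
    (hex : ∃ u : K, ‖u ^ p - ζ‖ ≤ ‖(p : K)‖ * ‖(ϖ : K)‖ ^ A) :
    (¬ ∃ u : K, ‖u‖ ≤ ‖(ϖ : K)‖ ^ (((absRamificationIdx p K / (p - 1) + 1 : ℕ) : ℤ) - 1) ∧ u ∉ logUnits K) ∧ p ∣ A := by
  have hc : IsInnerConductor K ϖ A := (isInnerConductor_tie_iff_exists_le_of_torsionPExp_eq_one p hϖ hA hp2 hm hζ hζ1).2 hex
  refine ⟨fun h => ?_, ?_⟩
  · have hc' := (exists_inner_certificate_rInUb_iff_isInnerConductor_succ p hϖ hA hp2).1 h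
    have := isInnerConductor_unique hc hc'
    omega
  · obtain ⟨u, hu⟩ := hex
    have hprim : IsPrimitiveRoot ζ (p ^ torsionPExp p K) := by
      rw [hm]; exact isPrimitiveRoot_pow_one_of_pow_prime_eq_one p hζ hζ1
    have h := pow_torsionPExp_dvd_level_of_torsionWitness p hϖ hA hp.out.pos hζ
      (not_pow_prime_eq_of_isPrimitiveRoot_torsionPExp p (by omega) hprim) hu
    rwa [hm, pow_one] at h

end Field

/-! ## §2. At the bed `K_x = kOf X p x` of a pilot datum -/

section Bed

variable {L : Type} [Field L] [NumberField L] (X : PilotData L)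

/-- **THE DEEP ROW AT THE BED, THROUGH THE DOOR**: at a place `x ∣ p` (`p` odd) of a pilot datum where, for some `ζ' ≠ 1` with `ζ'^p = 1` in
`K_x`, the congruence `‖u^p − ζ'‖ ≤ ‖p‖·‖ϖ‖^{e_x/(p−1)}` has NO solution: `(p−1) ∣ e_x`, `m_x = 1`, and the inner conductor is
`c_x = e_x/(p−1) + 1 = r_in_ub(x)`. [cite: SerreLocalFields1979, Ch. XIV §4] [cite: NeukirchANT1999, Ch. II Prop. (5.5)–(5.7)] -/
theorem torsionPExp_eq_one_and_isInnerConductor_kOf_rInUb_of_forall_lt (pp : Nat.Primes) [Fact (pp : ℕ).Prime] (hp2 : (pp : ℕ) ≠ 2)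
    (x : (thetaIndex X).Fibre (.inr pp)) {ζ' : kOf X pp.1 x} (hζ' : ζ' ^ (pp : ℕ) = 1) (hζ'1 : ζ' ≠ 1) {ϖ : (kOf X pp.1 x)ˣ}
    (hϖ : IsUniformizer ϖ)
    (hW : ∀ u : kOf X pp.1 x, ‖((pp : ℕ) : kOf X pp.1 x)‖ *
        ‖(ϖ : kOf X pp.1 x)‖ ^ ((placeOf X pp.1 x).asIdeal.ramificationIdx ℤ / ((pp : ℕ) - 1)) < ‖u ^ (pp : ℕ) - ζ'‖) :
    ((pp : ℕ) - 1 ∣ (placeOf X pp.1 x).asIdeal.ramificationIdx ℤ) ∧ torsionPExp pp (kOf X pp.1 x) = 1 ∧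
      IsInnerConductor (kOf X pp.1 x) ϖ ((placeOf X pp.1 x).asIdeal.ramificationIdx ℤ / ((pp : ℕ) - 1) + 1) := by
  have he : absRamificationIdx pp (kOf X pp.1 x) = (placeOf X pp.1 x).asIdeal.ramificationIdx ℤ :=
    absRamificationIdx_rescaledCompletion L pp.1 (placeOf X pp.1 x) (natCast_mem_placeOf X pp.1 x)
  have hm : torsionPExp pp (kOf X pp.1 x) = 1 := torsionPExp_eq_one_of_forall_lt (pp : ℕ) hζ' hζ'1 hW
  have hdvd : (pp : ℕ) - 1 ∣ absRamificationIdx pp (kOf X pp.1 x) := by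
    by_contra hnd
    have := torsionPExp_eq_zero_of_not_pred_dvd pp (kOf X pp.1 x) hnd
    omega
  rw [← he] at hW ⊢
  have hA : absRamificationIdx pp (kOf X pp.1 x) = absRamificationIdx pp (kOf X pp.1 x) / ((pp : ℕ) - 1) * ((pp : ℕ) - 1) :=
    (Nat.div_mul_cancel hdvd).symm
  exact ⟨hdvd, hm, isInnerConductor_tie_succ_of_forall_lt (pp : ℕ) hϖ hA hp2 hζ' hW⟩

/-- **… and 15R is CERTIFIED at `x`**: `∃ u ∉ log_p(𝒪_x^×)` with `‖u‖ ≤ ‖ϖ_x‖^{⌊e_x/(p−1)⌋}` (the k2 door's `hsharp` binder at the round-1 donor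
`n₀(x) = r_in_ub(x)`). [cite: NeukirchANT1999, Ch. II Prop. (5.5)–(5.7)] -/
theorem exists_inner_certificate_rInUb_kOf_of_forall_lt (pp : Nat.Primes) [Fact (pp : ℕ).Prime] (hp2 : (pp : ℕ) ≠ 2)
    (x : (thetaIndex X).Fibre (.inr pp)) {ζ' : kOf X pp.1 x} (hζ' : ζ' ^ (pp : ℕ) = 1) (hζ'1 : ζ' ≠ 1) {ϖ : (kOf X pp.1 x)ˣ}
    (hϖ : IsUniformizer ϖ)
    (hW : ∀ u : kOf X pp.1 x, ‖((pp : ℕ) : kOf X pp.1 x)‖ *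
        ‖(ϖ : kOf X pp.1 x)‖ ^ ((placeOf X pp.1 x).asIdeal.ramificationIdx ℤ / ((pp : ℕ) - 1)) < ‖u ^ (pp : ℕ) - ζ'‖) :
    ∃ u : kOf X pp.1 x, ‖u‖ ≤ ‖(ϖ : kOf X pp.1 x)‖ ^ ((((placeOf X pp.1 x).asIdeal.ramificationIdx ℤ / ((pp : ℕ) - 1) + 1 : ℕ) : ℤ) - 1) ∧
      u ∉ logUnits (kOf X pp.1 x) := by
  rw [exists_inner_certificate_iff_le hϖ.1.le
    (torsionPExp_eq_one_and_isInnerConductor_kOf_rInUb_of_forall_lt X pp hp2 x hζ' hζ'1 hϖ hW).2.2 (Nat.le_add_left 1 _)]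

end Bed

/-! ## §3. At the genuine Θ-volume datum over `p ∈ {3, 5}`: the generator-free door -/

section Genuine

open Literature.IUT.LogVolume.Cor22 Literature.NumberTheory.DiophantineGeometry.GenEll

variable {P : NFPoint} {l : ℕ} (T : ThetaVolumeDatumAt P l)

/-- **THE 32 DEEP GENUINE ROWS, KERNEL SIDE.** At a genuine Θ-volume datum `T` (`X := pilotDataOfK T.D T.K`), `p ∈ {3, 5}` (`p ∣ 30`, `p ≠ 2`;
`ζ_p ∈ K` structurally, p481931 `ThetaVolumeDatumAt.exists_pow_prime_eq_one_ne_one_K`), at a place `x ∣ p` and a norm uniformizer `ϖ` of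
`K_x`: IF the generator congruence is insoluble — `‖p‖·‖ϖ‖^{e_x/(p−1)} < ‖u^p − ζ'‖` for every `ζ' ≠ 1` with `ζ'^p = 1` and every `u` in `K_x`
(the claim of the TWO-ENGINE CERTIFICATE abc-iut-rh-kit-1 PASS 14 per deep row of class W1/W2) — THEN `m_x = 1`, the inner conductor is
`r_in_ub(x) = e_x/(p−1) + 1`, and the 15R certificate holds at `x`. The hypothesis is generator-free (no root of unity is chosen) and, by §1,
equivalent to its instance at any one `ζ'`. [cite: Mochizuki2012, IUTchIV Thm. 1.10 p. 22] [cite: SerreLocalFields1979, Ch. XIV §4]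
[cite: NeukirchANT1999, Ch. II Prop. (5.5)–(5.7)] [claim: Mochizuki2012, status: disputed] -/
theorem ThetaVolumeDatumAt.isInnerConductor_kOf_rInUb_of_forall_lt_of_dvd_thirty (pp : Nat.Primes) (hp30 : (pp : ℕ) ∣ 30)
    (hp2 : (pp : ℕ) ≠ 2) :
    letI := T.instFieldF; letI := T.instNumberFieldF; letI := T.instAlgebraF; letI := T.instFieldK; letI := T.instNumberFieldK;
    letI := T.instAlgebraK; letI := T.instFieldFbar; letI := T.instAlgebraFbar; letI := T.instAlgebraKFbar; letI := T.instIsElliptic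
    haveI : Fact (pp : ℕ).Prime := ⟨pp.2⟩
    ∀ (x : (thetaIndex (pilotDataOfK T.D T.K)).Fibre (.inr pp)) (ϖ : (kOf (pilotDataOfK T.D T.K) pp.1 x)ˣ), IsUniformizer ϖ →
      (∀ ζ' u : kOf (pilotDataOfK T.D T.K) pp.1 x, ζ' ^ (pp : ℕ) = 1 → ζ' ≠ 1 →
        ‖((pp : ℕ) : kOf (pilotDataOfK T.D T.K) pp.1 x)‖ *
            ‖(ϖ : kOf (pilotDataOfK T.D T.K) pp.1 x)‖ ^ ((placeOf (pilotDataOfK T.D T.K) pp.1 x).asIdeal.ramificationIdx ℤ / ((pp : ℕ) - 1)) <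
          ‖u ^ (pp : ℕ) - ζ'‖) →
      torsionPExp pp (kOf (pilotDataOfK T.D T.K) pp.1 x) = 1 ∧
        IsInnerConductor (kOf (pilotDataOfK T.D T.K) pp.1 x) ϖ
            ((placeOf (pilotDataOfK T.D T.K) pp.1 x).asIdeal.ramificationIdx ℤ / ((pp : ℕ) - 1) + 1) ∧
          ∃ u : kOf (pilotDataOfK T.D T.K) pp.1 x,
            ‖u‖ ≤ ‖(ϖ : kOf (pilotDataOfK T.D T.K) pp.1 x)‖ ^
                ((((placeOf (pilotDataOfK T.D T.K) pp.1 x).asIdeal.ramificationIdx ℤ / ((pp : ℕ) - 1) + 1 : ℕ) : ℤ) - 1) ∧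
              u ∉ logUnits (kOf (pilotDataOfK T.D T.K) pp.1 x) := by
  letI := T.instFieldF; letI := T.instNumberFieldF; letI := T.instAlgebraF; letI := T.instFieldK; letI := T.instNumberFieldK
  letI := T.instAlgebraK; letI := T.instFieldFbar; letI := T.instAlgebraFbar; letI := T.instAlgebraKFbar; letI := T.instIsElliptic
  haveI : Fact (pp : ℕ).Prime := ⟨pp.2⟩
  intro x ϖ hϖ hW
  obtain ⟨ζ, hζ, hζ1⟩ := ThetaVolumeDatumAt.exists_pow_prime_eq_one_ne_one_K T pp.2 hp30
  obtain ⟨ζ', hζ', hζ'1⟩ := exists_pow_eq_one_ne_one_kOf (pilotDataOfK T.D T.K) pp x hζ hζ1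
  have hW' := fun u => hW ζ' u hζ' hζ'1
  obtain ⟨-, hm, hc⟩ :=
    torsionPExp_eq_one_and_isInnerConductor_kOf_rInUb_of_forall_lt (pilotDataOfK T.D T.K) pp hp2 x hζ' hζ'1 hϖ hW'
  exact ⟨hm, hc, exists_inner_certificate_rInUb_kOf_of_forall_lt (pilotDataOfK T.D T.K) pp hp2 x hζ' hζ'1 hϖ hW'⟩

end Genuine

end Summit.ABC.IUTFork.Repair.RH.DeepTie

end
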